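import Summits.HubbardSuperconductivity.HubbardSuperconductivity.Theorems.AnisotropyChordTransferFibre3FinRCCell

/-!
# Route `AnisotropyChord` / H0 rotor rung: FIN regime certificate at `L = 15` — kernel facts, part e

KERNEL FACTS (zero data): cells of the λ-cover of the a-priori window at `L = 15` pass the regime check in CONVOLUTION form
`FinCell.mholeCellOK4 15 a b` (`…Fibre3FinRCCell` / `…Fibre3FinConvCell`: layer-0/1 positivity, then either the cell is vacuous —
the anisotropy enclosure lies below `0` — or `‖Π⁰‖² > 0` and `hi(T⁺) ≤ lo(ε₁(1 − 5/V + 6/V²)/2)`, `T⁺ = 3λ − 6·Σ_x φ(x)Σ_y φ(y)f(y−x)² / ‖Π⁰‖²`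
by row dot products over the `V²` pairs), one `decide +kernel` each (`maxHeartbeats 400000` pre-budgeted). The cell list
(15 points, units of `D = 2^60`; designed with the prover's float mirror `scratch/fin_iv3.py`) is assembled in `…Fibre3FinMHoleFifteen`.
Prover seat `hubbard-h0-rotor-p3` g4; helper for stmt-HubbardSuperconductivity-23918 (piece A of rung 19089; `--supports`, helper class).
WHAT THIS IS NOT: nothing here proves superconductivity in the Hubbard model (rotor TARGET as worded stays FALSE, g15 verdict); kernel
facts for ONE hypothesis (regime clause) of ONE conditional reduction at one `L`. Tree imports only; no sorry, no `native_decide`.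
-/

set_option linter.dupNamespace false
set_option autoImplicit false

namespace Summit.HubbardSuperconductivity.HubbardSuperconductivity.Theorems.AnisotropyChord.Transfer.Fibre3

namespace FinCell

set_option maxHeartbeats 400000 in
/-- kernel fact: cell 9 of 14 at `L = 15`, `λ·2^60 ∈ [10233868675771400, 11566986147698778]`, passes the regime check (row–column tables, convolution form). [folklore] -/
theorem cell15_9 : mholeCellOK4 15 10233868675771400 11566986147698778 = true := by
  decide +kernel

set_option maxHeartbeats 400000 in
/-- kernel fact: cell 10 of 14 at `L = 15`, `λ·2^60 ∈ [11566986147698778, 13699974102782584]`, passes the regime check (row–column tables, convolution form). [folklore] -/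
theorem cell15_10 : mholeCellOK4 15 11566986147698778 13699974102782584 = true := by
  decide +kernel

set_option maxHeartbeats 400000 in
/-- kernel fact: cell 11 of 14 at `L = 15`, `λ·2^60 ∈ [13699974102782584, 17112754830916674]`, passes the regime check (row–column tables, convolution form). [folklore] -/
theorem cell15_11 : mholeCellOK4 15 13699974102782584 17112754830916674 = true := by
  decide +kernel

set_option maxHeartbeats 400000 in
/-- kernel fact: cell 12 of 14 at `L = 15`, `λ·2^60 ∈ [17112754830916674, 18488876585220608]`, passes the regime check (row–column tables, convolution form). [folklore] -/
theorem cell15_12 : mholeCellOK4 15 17112754830916674 18488876585220608 = true := by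
  decide +kernel

set_option maxHeartbeats 400000 in
/-- kernel fact: cell 13 of 14 at `L = 15`, `λ·2^60 ∈ [18488876585220608, 19176937462372576]`, passes the regime check (row–column tables, convolution form). [folklore] -/
theorem cell15_13 : mholeCellOK4 15 18488876585220608 19176937462372576 = true := by
  decide +kernel

set_option maxHeartbeats 400000 in
/-- kernel fact: cell 14 of 14 at `L = 15`, `λ·2^60 ∈ [19176937462372576, 19864998339524544]`, passes the regime check (row–column tables, convolution form). [folklore] -/
theorem cell15_14 : mholeCellOK4 15 19176937462372576 19864998339524544 = true := by
  decide +kernel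

end FinCell

end Summit.HubbardSuperconductivity.HubbardSuperconductivity.Theorems.AnisotropyChord.Transfer.Fibre3
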